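import Summits.BirchSwinnertonDyer.Rank1Residual.X1.MuLambdaAlgebra
import Literature.NumberTheory.EllipticCurves.PAdicBSD
import HarnessLib

/-!
# Route `ResidualThetaTransportAtTwo`, crux Kμ⁺ `SignedMuVanishingAtTwoPlus` (stmt-BirchSwinnertonDyer-20689),
# analytic child `SignedMuAnalyticAtTwoPlus` (stmt-21437): the `Λ`-algebra of the `μ(G) = m` bookkeeping

Pure algebra of `Λ = ℤ_p⟦T⟧` (any prime `p`; Mathlib + the tree's `X1.MuLambda` API), helper for the
lead line `birth` of the crux (seat bsd-wall-rtt-p4). The analytic conjunct of Kμ⁺ reads, for the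
period ratio `ϖ ∈ ℚ` (`ϖ · Ω_W = Ω⁺_f`) and Kobayashi's `L = L♭_W ∈ Λ`:
"for every `G ∈ Λ` and `m ≥ 0` with `ι G = p^m · ϖ · ι L` in `ℚ_p⟦T⟧`, `μ(G) = m`".
This file proves that, as soon as `ϖ` is a `p`-adic unit (at `p = 2` on the habitat: Abbes–Ullmo /
Greenberg–Vatsal, tree fact `realPeriodRat_eq_unit_mul_plusPeriod_two`), that bookkeeping is
EQUIVALENT to `μ(L) = 0`, i.e. `p ∤ L` in `Λ`:
* `exists_units_coe_eq_of_norm_ratCast_eq_one` — a rational of `p`-adic norm `1` is a unit of `ℤ_p`;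
* `eq_C_pow_mul_of_map_eq` — `ι G = C(p^m ϖ) · ι L` with `ϖ = u ∈ ℤ_pˣ` gives `G = C(p^m) · (C u · L)` in `Λ`;
* `mu_eq_of_map_eq_of_not_C_dvd` — **`p ∤ L ⇒ μ(G) = m`** (`X1.MuLambda.mu_eq_and_pfree_eq`);
* `C_dvd_of_map_eq_of_mu_eq` / `mu_eq_iff_not_C_dvd_of_map_eq` — conversely `μ(G) = m ⇒ p ∤ L` (for `L ≠ 0`);
* `not_C_dvd_of_isUnit_coeff`, `not_C_dvd_of_norm_constantCoeff_eq_one` — the per-class CERTIFICATE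
  shape: one unit coefficient (e.g. the constant term `L(0)`) gives `p ∤ L`.
Nothing about any curve is asserted; BSD is not proved by this. [cite: GreenbergVatsal2000, p. 2, (2)]
-/

set_option autoImplicit false
set_option linter.dupNamespace false

noncomputable section

open scoped Classical

open Literature.NumberTheory.EllipticCurves Summit.BirchSwinnertonDyer.Rank1Residual.X1

namespace Summit.BirchSwinnertonDyer.BirchSwinnertonDyer.Theorems.SignedMuAtTwo

variable {p : ℕ} [Fact p.Prime]

/-- A rational number of `p`-adic norm `1` is (the image of) a unit of `ℤ_p`. [folklore] -/
theorem exists_units_coe_eq_of_norm_ratCast_eq_one {ϖ : ℚ} (h : ‖(ϖ : ℚ_[p])‖ = 1) :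
    ∃ u : ℤ_[p]ˣ, ((u : ℤ_[p]) : ℚ_[p]) = ϖ := by
  set z : ℤ_[p] := ⟨(ϖ : ℚ_[p]), le_of_eq h⟩ with hz
  have hzu : IsUnit z := PadicInt.isUnit_iff.mpr (by rw [PadicInt.norm_def]; exact h)
  exact ⟨hzu.unit, by rw [IsUnit.unit_spec]⟩

/-- **Descent to `Λ`**: if `ι G = C(p^m · u) · ι L` in `ℚ_p⟦T⟧` with `u ∈ ℤ_pˣ`, then
`G = C(p^m) · (C u · L)` in `Λ` (`ι` is an injective ring map). [folklore] -/
theorem eq_C_pow_mul_of_map_eq {G L : IwasawaAlgebra p} {m : ℕ} (u : ℤ_[p]ˣ)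
    (hG : iwasawaToPowerSeries p G =
      PowerSeries.C ((p : ℚ_[p]) ^ m * ((u : ℤ_[p]) : ℚ_[p])) * iwasawaToPowerSeries p L) :
    G = PowerSeries.C ((p : ℤ_[p]) ^ m) * (PowerSeries.C (u : ℤ_[p]) * L) := by
  -- `ι (C c) = C c` (also landed as `…AdditiveBranchIMCGordTwoRankZeroLambdaAdic.iwasawaToPowerSeries_C`;
  -- kept local to avoid importing that route's module for a `simp` lemma)
  have hC : ∀ c : ℤ_[p], iwasawaToPowerSeries p (PowerSeries.C c) = PowerSeries.C ((c : ℤ_[p]) : ℚ_[p]) :=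
    fun c ↦ by simp [iwasawaToPowerSeries]
  apply iwasawaToPowerSeries_injective p
  rw [hG, map_mul (iwasawaToPowerSeries p), map_mul (iwasawaToPowerSeries p), hC, hC, ← mul_assoc,
    ← map_mul PowerSeries.C, PadicInt.coe_pow, PadicInt.coe_natCast]

/-- Multiplying by `C u`, `u ∈ ℤ_pˣ`, does not change divisibility by `p` in `Λ`. [folklore] -/
theorem C_dvd_C_units_mul_iff (u : ℤ_[p]ˣ) (L : IwasawaAlgebra p) :
    PowerSeries.C (p : ℤ_[p]) ∣ PowerSeries.C (u : ℤ_[p]) * L ↔ PowerSeries.C (p : ℤ_[p]) ∣ L :=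
  IsUnit.dvd_mul_left ((Units.isUnit u).map PowerSeries.C)

/-- **`p ∤ L ⇒ μ(G) = m`**: for `ϖ ∈ ℚ` a `p`-adic unit, `L ∈ Λ` not divisible by `p` (`μ(L) = 0`)
and `G ∈ Λ` with `ι G = C(p^m ϖ) · ι L`, the `μ`-invariant of `G` (`X1.MuLambda.mu`, the exact power
of `p` dividing `G`) is `m`. The sufficient direction of the Kμ⁺ analytic bookkeeping.
[cite: GreenbergVatsal2000, p. 2, (2)] -/
theorem mu_eq_of_map_eq_of_not_C_dvd {G L : IwasawaAlgebra p} {ϖ : ℚ} {m : ℕ}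
    (hϖ : ‖(ϖ : ℚ_[p])‖ = 1) (hL : ¬ PowerSeries.C (p : ℤ_[p]) ∣ L)
    (hG : iwasawaToPowerSeries p G =
      PowerSeries.C ((p : ℚ_[p]) ^ m * (ϖ : ℚ_[p])) * iwasawaToPowerSeries p L) :
    MuLambda.mu G = m := by
  obtain ⟨u, hu⟩ := exists_units_coe_eq_of_norm_ratCast_eq_one hϖ
  rw [← hu] at hG
  have hG' := eq_C_pow_mul_of_map_eq u hG
  have hred : MuLambda.red (PowerSeries.C (u : ℤ_[p]) * L) ≠ 0 := by
    rw [Ne, MuLambda.red_eq_zero_iff, C_dvd_C_units_mul_iff]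
    exact hL
  exact (MuLambda.mu_eq_and_pfree_eq hred hG').1

/-- **`p ∣ L ⇒ p^{m+1} ∣ G`** under the same bookkeeping identity. [folklore] -/
theorem C_pow_succ_dvd_of_map_eq_of_C_dvd {G L : IwasawaAlgebra p} {ϖ : ℚ} {m : ℕ}
    (hϖ : ‖(ϖ : ℚ_[p])‖ = 1) (hL : PowerSeries.C (p : ℤ_[p]) ∣ L)
    (hG : iwasawaToPowerSeries p G =
      PowerSeries.C ((p : ℚ_[p]) ^ m * (ϖ : ℚ_[p])) * iwasawaToPowerSeries p L) :
    PowerSeries.C ((p : ℤ_[p]) ^ (m + 1)) ∣ G := by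
  obtain ⟨u, hu⟩ := exists_units_coe_eq_of_norm_ratCast_eq_one hϖ
  rw [← hu] at hG
  obtain ⟨L₁, rfl⟩ := hL
  refine ⟨PowerSeries.C (u : ℤ_[p]) * L₁, ?_⟩
  rw [eq_C_pow_mul_of_map_eq u hG, pow_succ, map_mul]
  ring

/-- **`μ(G) = m ⇒ p ∤ L`** (for `L ≠ 0`): the necessary direction — if `p ∣ L` then `p^{m+1} ∣ G ≠ 0`,
so `μ(G) ≥ m + 1`. [cite: GreenbergVatsal2000, p. 2, (2)] -/
theorem not_C_dvd_of_map_eq_of_mu_eq {G L : IwasawaAlgebra p} {ϖ : ℚ} {m : ℕ}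
    (hϖ : ‖(ϖ : ℚ_[p])‖ = 1) (hL0 : L ≠ 0)
    (hG : iwasawaToPowerSeries p G =
      PowerSeries.C ((p : ℚ_[p]) ^ m * (ϖ : ℚ_[p])) * iwasawaToPowerSeries p L)
    (hμ : MuLambda.mu G = m) : ¬ PowerSeries.C (p : ℤ_[p]) ∣ L := by
  intro hL
  have hG0 : G ≠ 0 := by
    obtain ⟨u, hu⟩ := exists_units_coe_eq_of_norm_ratCast_eq_one hϖ
    rw [← hu] at hG
    rw [eq_C_pow_mul_of_map_eq u hG]
    exact mul_ne_zero (MuLambda.C_pow_ne_zero m)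
      (mul_ne_zero (((Units.isUnit u).map PowerSeries.C).ne_zero) hL0)
  have := MuLambda.le_mu_of_C_pow_dvd hG0 (C_pow_succ_dvd_of_map_eq_of_C_dvd hϖ hL hG)
  omega

/-- **The bookkeeping is exactly `μ(L) = 0`**: for `ϖ` a `p`-adic unit, `L ≠ 0` and `ι G = C(p^m ϖ)·ι L`,
`μ(G) = m ↔ p ∤ L`. [cite: GreenbergVatsal2000, p. 2, (2)] -/
theorem mu_eq_iff_not_C_dvd_of_map_eq {G L : IwasawaAlgebra p} {ϖ : ℚ} {m : ℕ}
    (hϖ : ‖(ϖ : ℚ_[p])‖ = 1) (hL0 : L ≠ 0)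
    (hG : iwasawaToPowerSeries p G =
      PowerSeries.C ((p : ℚ_[p]) ^ m * (ϖ : ℚ_[p])) * iwasawaToPowerSeries p L) :
    MuLambda.mu G = m ↔ ¬ PowerSeries.C (p : ℤ_[p]) ∣ L :=
  ⟨not_C_dvd_of_map_eq_of_mu_eq hϖ hL0 hG, fun hL ↦ mu_eq_of_map_eq_of_not_C_dvd hϖ hL hG⟩

/-- **Certificate shape**: one unit coefficient of `L ∈ Λ` gives `p ∤ L` (`μ(L) = 0`). [folklore] -/
theorem not_C_dvd_of_isUnit_coeff {L : IwasawaAlgebra p} (k : ℕ) (hk : IsUnit (PowerSeries.coeff k L)) :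
    ¬ PowerSeries.C (p : ℤ_[p]) ∣ L := by
  intro h
  have hp : (p : ℤ_[p]) ∣ PowerSeries.coeff k L := (PowerSeries.C_dvd_iff_forall_dvd_coeff _ L).mp h k
  exact PadicInt.irreducible_p.not_isUnit (isUnit_of_dvd_unit hp hk)

/-- The constant-term certificate in the `ℚ_p`-norm form used by the tree's constant-term identities:
`‖L(0)‖_p = 1 ⇒ p ∤ L`. [folklore] -/
theorem not_C_dvd_of_norm_constantCoeff_eq_one {L : IwasawaAlgebra p}
    (h : ‖((PowerSeries.constantCoeff L : ℤ_[p]) : ℚ_[p])‖ = 1) :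
    ¬ PowerSeries.C (p : ℤ_[p]) ∣ L := by
  refine not_C_dvd_of_isUnit_coeff 0 ?_
  rw [PowerSeries.coeff_zero_eq_constantCoeff, PadicInt.isUnit_iff, PadicInt.norm_def]
  exact h

end Summit.BirchSwinnertonDyer.BirchSwinnertonDyer.Theorems.SignedMuAtTwo

end
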